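import Mathlib
import Literature.Combinatorics.Optimization.ReflectionRelations
import HarnessLib

/-!
# Polyhedral relations (Kaibel–Pashkovich 2011, §2): images, composition, the extended formulation of
# an image (Remark 1), and affinely generated relations (Proposition 1) — PROVED

Source: V. Kaibel, K. Pashkovich, *Constructing extended formulations from reflection relations*,
IPCO 2011 [KaibelPashkovich2011] (held text `paper:arxiv-1011.3597`, §2, arXiv pp. 5–6). Verbatim:
"A polyhedral relation of type `(n, m)` is a non-empty polyhedron `∅ ≠ R ⊆ ℝⁿ × ℝ^m`. The image of a
subset `X ⊆ ℝⁿ` under such a polyhedral relation `R` is denoted by `R(X) = {y ∈ ℝ^m : (x, y) ∈ R for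
some x ∈ X}`. Clearly, we have the monotonicity relations `R(X) ⊆ R(X̃)` for `X ⊆ X̃`. … A sequential
polyhedral relation of type `(k_0, …, k_r)` is a sequence `(R_1, …, R_r)` …; we denote by `𝓡` the set
of all `(z^{(0)}, z^{(r)})` for which there is some `(z^{(1)}, …, z^{(r−1)})` with
`(z^{(i−1)}, z^{(i)}) ∈ R_i` for all `i` … For a polyhedron `P ⊆ ℝ^{k_0}`, the polyhedron `Q` defined
by `z^{(0)} ∈ P` and `(z^{(i−1)}, z^{(i)}) ∈ R_i` for all `i ∈ [r]` (1) satisfies `π(Q) = 𝓡(P)` …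
Thus, (1) provides an extended formulation of the polyhedron `𝓡(P)` with `k_0 + ⋯ + k_r` variables
and `f_0 + ⋯ + f_r` constraints, provided we have linear descriptions of the polyhedra `P, R_1, …, R_r`
with `f_0, f_1, …, f_r` constraints, respectively. … **Remark 1.** … If the polyhedron `P ⊆ ℝ^{k_0}`
has an extended formulation with `k'` variables and `f'` inequalities, then we can construct an
extended formulation for `𝓡(P)` with … `f' + f_1 + ⋯ + f_r` constraints. … The domain of a
polyhedral relation … `dom(R) = {x ∈ ℝⁿ : (x, y) ∈ R for some y ∈ ℝ^m}`. We clearly have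
`R(X) = ⋃_{x ∈ X ∩ dom(R)} R(x)` for all `X ⊆ ℝⁿ`. Note that, for a polytope `P = conv(V)` … in
general the inclusion `conv ⋃_{v ∈ V} R(v) ⊆ R(P)` (2) holds without equality … We call a relation
`R ⊆ ℝⁿ × ℝ^m` affinely generated by the family `(ϱ^{(f)})_{f ∈ F}`, if `F` is finite and every
`ϱ^{(f)} : ℝⁿ → ℝ^m` is an affine map such that `R(x) = conv ⋃_{f ∈ F} ϱ^{(f)}(x)` holds for all
`x ∈ dom(R)`. … For such a polyhedral relation `R` and a polytope `P ⊆ ℝⁿ` with `P ∩ dom(R) = conv(V)`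
for some `V ⊆ ℝⁿ`, we find `R(P) = ⋃ R(x) = ⋃ conv ⋃_f ϱ^{(f)}(x) ⊆ conv ⋃_x ⋃_f ϱ^{(f)}(x) = conv
⋃_{v ∈ V} ⋃_f ϱ^{(f)}(v) ⊆ conv ⋃_{v ∈ V} R(v)`, where, due to (2), all inclusions are equations. In
particular, we have established the following result. **Proposition 1.** For every polyhedral relation
`R ⊆ ℝⁿ × ℝ^m` that is affinely generated by a finite family `(ϱ^{(f)})_{f ∈ F}`, and for every
polytope `P ⊆ ℝⁿ`, we have `R(P) = conv ⋃_{f ∈ F} ϱ^{(f)}(P ∩ dom(R))` (3)."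

## What is proved (no named fact), in the tree's slack-form currency `HasEFOfSize`

* `relImage R X = R(X)`, `relDom R = dom(R)`, monotonicity, `relImage_eq_biUnion`
  (`R(X) = ⋃_{x ∈ X ∩ dom R} R(x)`), composition `relComp` of two relations and
  `relImage_relComp : (R₂ ∘ R₁)(X) = R₂(R₁(X))` (the induced relation of a sequence of length two;
  longer sequences by iteration), convexity `convex_relImage`;
* EF calculus: `HasEFOfSize.inter` (`xc(P ∩ Q) ≤ xc(P) + xc(Q)`: stack the two slack systems),
  `HasEFOfSize.cylinder` (pulling `P` back to `ℝ^{ι ⊕ κ}` is free), and **Remark 1**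
  `KaibelPashkovich2011_remark1 : HasEFOfSize P r → HasEFOfSize (relSet R) f →
  HasEFOfSize (relImage R P) (r + f)` (`relSet R ⊆ ℝ^{ι ⊕ κ}` is the relation as a polyhedron), and its
  two-step form `KaibelPashkovich2011_remark1_comp` (`r + f₁ + f₂`);
* the inclusion (2) `convexHull_biUnion_relImage_subset` for CONVEX relations, `AffinelyGenerated`, and
  **Proposition 1** `KaibelPashkovich2011_prop1 : R(P) = conv ⋃_f ϱ^{(f)}(P ∩ dom R)` for a convex
  relation affinely generated by finitely many affine maps and `P ∩ dom(R) = conv V`, `P` convex;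
* the link to `ReflectionRelations.lean`: `reflImage a β X = relImage (reflRel a β) X`
  (`reflImage_eq_relImage`), and the reflection relation is affinely generated by `{id, ϱ_H}`
  (`affinelyGenerated_reflRel`, from Proposition 2 there);
* **Lemma 1** for two relations: `KaibelPashkovich2011_lemma1_comp`
  (`𝓡(P) ⊆ conv ⋃_{(f₁,f₂)} ϱ₂^{(f₂)}ϱ₁^{(f₁)}(P ∩ dom 𝓡)`).

Deviations from print: relations are arbitrary subsets of `ℝ^ι × ℝ^κ` (convexity / an EF of `relSet R`
is assumed where used, in place of "polyhedron"); the variable count of Remark 1 is not tracked; the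
hypothesis "`P ∩ dom(R) = conv V`" of the derivation of Proposition 1 is kept explicit (for a polytope
and a polyhedral `R` it holds by Minkowski–Weyl, not invoked here); Lemma 1 (proof omitted in print) is
formalised for sequences of length two (`KaibelPashkovich2011_lemma1_comp`; longer sequences by
iterating `relComp`). Honest framing: Literature infrastructure on extended formulations; nothing here bears on
`P ≠ NP`.
-/

noncomputable section

namespace Literature.Combinatorics.Optimization

open Matrix Finset Literature.Barriers.PneNP

variable {ι κ μ : Type} [Fintype ι] [Fintype κ] [Fintype μ]

/-! ### Images, domains, composition -/

/-- The image `R(X) = {y : (x, y) ∈ R for some x ∈ X}`. [cite: KaibelPashkovich2011, §2 (arXiv p. 5)] -/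
def relImage (R : Set ((ι → ℝ) × (κ → ℝ))) (X : Set (ι → ℝ)) : Set (κ → ℝ) :=
  {y | ∃ x ∈ X, (x, y) ∈ R}

/-- The domain `dom(R) = {x : (x, y) ∈ R for some y}`. [cite: KaibelPashkovich2011, §2 (arXiv p. 5)] -/
def relDom (R : Set ((ι → ℝ) × (κ → ℝ))) : Set (ι → ℝ) := {x | ∃ y, (x, y) ∈ R}

omit [Fintype ι] [Fintype κ] in
/-- "the monotonicity relations `R(X) ⊆ R(X̃)` for `X ⊆ X̃`". [cite: KaibelPashkovich2011, §2 (arXiv p. 5)] -/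
theorem relImage_mono (R : Set ((ι → ℝ) × (κ → ℝ))) {X X' : Set (ι → ℝ)} (h : X ⊆ X') :
    relImage R X ⊆ relImage R X' := by
  rintro y ⟨x, hx, hxy⟩
  exact ⟨x, h hx, hxy⟩

omit [Fintype ι] [Fintype κ] in
/-- "`R(X) = ⋃_{x ∈ X ∩ dom(R)} R(x)`". [cite: KaibelPashkovich2011, §2 (arXiv p. 5)] -/
theorem relImage_eq_biUnion (R : Set ((ι → ℝ) × (κ → ℝ))) (X : Set (ι → ℝ)) :
    relImage R X = ⋃ x ∈ X ∩ relDom R, relImage R {x} := by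
  ext y
  simp only [relImage, Set.mem_setOf_eq, Set.mem_iUnion, Set.mem_inter_iff, Set.mem_singleton_iff,
    exists_prop, exists_eq_left, relDom]
  constructor
  · rintro ⟨x, hx, hxy⟩
    exact ⟨x, ⟨hx, y, hxy⟩, hxy⟩
  · rintro ⟨x, ⟨hx, -⟩, hxy⟩
    exact ⟨x, hx, hxy⟩

/-- The relation induced by the sequence `(R₁, R₂)`: `{(x, z) : (x, y) ∈ R₁, (y, z) ∈ R₂ for some y}`.
[cite: KaibelPashkovich2011, §2 (arXiv p. 5)] -/
def relComp (R₁ : Set ((ι → ℝ) × (κ → ℝ))) (R₂ : Set ((κ → ℝ) × (μ → ℝ))) : Set ((ι → ℝ) × (μ → ℝ)) :=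
  {p | ∃ y, (p.1, y) ∈ R₁ ∧ (y, p.2) ∈ R₂}

omit [Fintype ι] [Fintype κ] [Fintype μ] in
/-- Images under the induced relation are iterated images. [cite: KaibelPashkovich2011, §2 (arXiv p. 5)] -/
theorem relImage_relComp (R₁ : Set ((ι → ℝ) × (κ → ℝ))) (R₂ : Set ((κ → ℝ) × (μ → ℝ))) (X : Set (ι → ℝ)) :
    relImage (relComp R₁ R₂) X = relImage R₂ (relImage R₁ X) := by
  ext z
  simp only [relImage, relComp, Set.mem_setOf_eq]
  constructor
  · rintro ⟨x, hx, y, hxy, hyz⟩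
    exact ⟨y, ⟨x, hx, hxy⟩, hyz⟩
  · rintro ⟨y, ⟨x, hx, hxy⟩, hyz⟩
    exact ⟨x, hx, y, hxy, hyz⟩

omit [Fintype ι] [Fintype κ] in
/-- "images of … convex sets under polyhedral relations are … convex sets" (for a convex relation).
[cite: KaibelPashkovich2011, §2 (arXiv p. 5)] -/
theorem convex_relImage {R : Set ((ι → ℝ) × (κ → ℝ))} (hR : Convex ℝ R) {X : Set (ι → ℝ)}
    (hX : Convex ℝ X) : Convex ℝ (relImage R X) := by
  intro y₁ h₁ y₂ h₂ a b ha hb hab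
  obtain ⟨x₁, hx₁, hr₁⟩ := h₁
  obtain ⟨x₂, hx₂, hr₂⟩ := h₂
  refine ⟨a • x₁ + b • x₂, hX hx₁ hx₂ ha hb hab, ?_⟩
  have := hR hr₁ hr₂ ha hb hab
  simpa using this

/-- The reflection images of `ReflectionRelations.lean` are relation images.
[cite: KaibelPashkovich2011, §3 (arXiv p. 7)] -/
theorem reflImage_eq_relImage (a : ι → ℝ) (β : ℝ) (X : Set (ι → ℝ)) :
    reflImage a β X = relImage (reflRel a β) X := rfl

/-! ### The extended formulation of an image (Remark 1) -/

/-- A relation `R ⊆ ℝ^ι × ℝ^κ` as a subset of `ℝ^{ι ⊕ κ}` (to speak of its extended formulations).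
[cite: KaibelPashkovich2011, §2 (arXiv p. 5: "linear descriptions of the polyhedra `P, R_1, …, R_r`")] -/
def relSet (R : Set ((ι → ℝ) × (κ → ℝ))) : Set (ι ⊕ κ → ℝ) :=
  {z | ((fun i => z (Sum.inl i)), fun k => z (Sum.inr k)) ∈ R}

/-- **Intersections add sizes**: `HasEFOfSize P r₁ → HasEFOfSize Q r₂ → HasEFOfSize (P ∩ Q) (r₁ + r₂)`
(stack the two slack systems). [cite: KaibelPashkovich2011, §2 (arXiv p. 5: "`f_0 + ⋯ + f_r` constraints")] -/
theorem _root_.Literature.Barriers.PneNP.HasEFOfSize.inter {P Q : Set (ι → ℝ)} {r₁ r₂ : ℕ}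
    (hP : HasEFOfSize P r₁) (hQ : HasEFOfSize Q r₂) : HasEFOfSize (P ∩ Q) (r₁ + r₂) := by
  classical
  obtain ⟨A, hA⟩ := hP
  obtain ⟨B, hB⟩ := hQ
  subst hA hB
  have h0 := hasEFOfSize_of_system (ι := ι) (Matrix.fromRows A.E B.E)
    (Matrix.fromBlocks A.F 0 0 B.F) (Sum.elim A.g B.g)
  rw [Fintype.card_sum, Fintype.card_fin, Fintype.card_fin] at h0
  convert h0 using 1
  ext x
  simp only [Set.mem_inter_iff, ExtendedFormulation.projSet, Set.mem_setOf_eq, Matrix.fromRows_mulVec,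
    Matrix.fromBlocks_mulVec, Matrix.zero_mulVec, add_zero, zero_add, sumElim_add_sumElim_eq_sumElim_iff]
  constructor
  · rintro ⟨⟨y, hy, hy'⟩, ⟨w, hw, hw'⟩⟩
    refine ⟨Sum.elim y w, ?_, hy', hw'⟩
    rintro (j | j)
    · exact hy j
    · exact hw j
  · rintro ⟨y, hy, h1, h2⟩
    exact ⟨⟨y ∘ Sum.inl, fun j => hy _, h1⟩, ⟨y ∘ Sum.inr, fun j => hy _, h2⟩⟩

/-- **Cylinders are free**: an EF of `P ⊆ ℝ^ι` gives one of `{z ∈ ℝ^{ι ⊕ κ} : z|_ι ∈ P}` of the same size.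
[cite: KaibelPashkovich2011, §2 (arXiv p. 5: the polyhedron `Q`, `z^{(0)} ∈ P`)] -/
theorem _root_.Literature.Barriers.PneNP.HasEFOfSize.cylinder {P : Set (ι → ℝ)} {r : ℕ} (hP : HasEFOfSize P r)
    (κ : Type) [Fintype κ] : HasEFOfSize {z : ι ⊕ κ → ℝ | (fun i => z (Sum.inl i)) ∈ P} r := by
  classical
  obtain ⟨A, hA⟩ := hP
  subst hA
  have h0 := hasEFOfSize_of_system (ι := ι ⊕ κ) (Matrix.of fun (p : Fin A.k) (s : ι ⊕ κ) =>
      Sum.elim (fun i => A.E p i) (fun _ => (0 : ℝ)) s) A.F A.g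
  rw [Fintype.card_fin] at h0
  convert h0 using 1
  ext z
  have hmul : (Matrix.of fun (p : Fin A.k) (s : ι ⊕ κ) => Sum.elim (fun i => A.E p i) (fun _ => (0 : ℝ)) s) *ᵥ z =
      A.E *ᵥ fun i => z (Sum.inl i) := by
    funext p
    simp [Matrix.mulVec, dotProduct, Fintype.sum_sum_type]
  simp only [Set.mem_setOf_eq, ExtendedFormulation.projSet, hmul]

/-- **Remark 1** (one relation): an EF of `P` with `r` inequalities and a description of `R` with `f`
inequalities give an EF of `R(P)` with `r + f` inequalities — `R(P)` is the projection to the second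
factor of `{(x, y) ∈ R : x ∈ P}`. [cite: KaibelPashkovich2011, Remark 1 (arXiv p. 5)] -/
theorem KaibelPashkovich2011_remark1 {P : Set (ι → ℝ)} {r f : ℕ} (hP : HasEFOfSize P r)
    {R : Set ((ι → ℝ) × (κ → ℝ))} (hR : HasEFOfSize (relSet R) f) :
    HasEFOfSize (relImage R P) (r + f) := by
  have h := ((hP.cylinder κ).inter hR).image_comp' (Sum.inr : κ → ι ⊕ κ)
  convert h using 2
  ext y
  simp only [relImage, Set.mem_setOf_eq, Set.mem_image, Set.mem_inter_iff, relSet]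
  constructor
  · rintro ⟨x, hx, hxy⟩
    refine ⟨Sum.elim x y, ⟨by simpa using hx, by simpa using hxy⟩, ?_⟩
    funext k; simp
  · rintro ⟨z, ⟨hz1, hz2⟩, rfl⟩
    exact ⟨fun i => z (Sum.inl i), hz1, hz2⟩

/-- **Remark 1** for a sequence of length two: `f' + f_1 + f_2`. [cite: KaibelPashkovich2011, Remark 1 (arXiv p. 5)] -/
theorem KaibelPashkovich2011_remark1_comp {P : Set (ι → ℝ)} {r f₁ f₂ : ℕ} (hP : HasEFOfSize P r)
    {R₁ : Set ((ι → ℝ) × (κ → ℝ))} {R₂ : Set ((κ → ℝ) × (μ → ℝ))} (h₁ : HasEFOfSize (relSet R₁) f₁)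
    (h₂ : HasEFOfSize (relSet R₂) f₂) : HasEFOfSize (relImage (relComp R₁ R₂) P) (r + f₁ + f₂) := by
  rw [relImage_relComp]
  exact KaibelPashkovich2011_remark1 (KaibelPashkovich2011_remark1 hP h₁) h₂

/-! ### Affinely generated relations (Proposition 1) -/

omit [Fintype ι] [Fintype κ] in
/-- **The inclusion (2)**: `conv ⋃_{v ∈ V} R(v) ⊆ R(conv V)` for a convex relation.
[cite: KaibelPashkovich2011, §2, eq. (2) (arXiv p. 5)] -/
theorem convexHull_biUnion_relImage_subset {R : Set ((ι → ℝ) × (κ → ℝ))} (hR : Convex ℝ R) (V : Set (ι → ℝ)) :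
    convexHull ℝ (⋃ v ∈ V, relImage R {v}) ⊆ relImage R (convexHull ℝ V) := by
  refine convexHull_min ?_ (convex_relImage hR (convex_convexHull ℝ V))
  intro y hy
  simp only [Set.mem_iUnion, exists_prop] at hy
  obtain ⟨v, hv, hyv⟩ := hy
  exact relImage_mono R (by simpa using subset_convexHull ℝ V hv) hyv

/-- `R` is **affinely generated** by the finite family `(ϱ^{(f)})_{f ∈ F}` of affine maps: `R(x) = conv
⋃_f ϱ^{(f)}(x)` for all `x ∈ dom(R)`. [cite: KaibelPashkovich2011, §2 (arXiv p. 5)] -/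
def AffinelyGenerated (R : Set ((ι → ℝ) × (κ → ℝ))) {F : Type} (ρ : F → (ι → ℝ) →ᵃ[ℝ] (κ → ℝ)) : Prop :=
  ∀ x ∈ relDom R, relImage R {x} = convexHull ℝ (Set.range fun f => ρ f x)

omit [Fintype ι] [Fintype κ] in
/-- **KP11 Proposition 1**: for a convex relation affinely generated by finitely many affine maps and a
convex `P` with `P ∩ dom(R) = conv V`, `R(P) = conv ⋃_f ϱ^{(f)}(P ∩ dom(R))`.
[cite: KaibelPashkovich2011, Prop. 1 (arXiv pp. 5–6)] -/
theorem KaibelPashkovich2011_prop1 {R : Set ((ι → ℝ) × (κ → ℝ))} (hR : Convex ℝ R) {F : Type} [Finite F]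
    {ρ : F → (ι → ℝ) →ᵃ[ℝ] (κ → ℝ)} (hgen : AffinelyGenerated R ρ) {P V : Set (ι → ℝ)}
    (hPV : P ∩ relDom R = convexHull ℝ V) :
    relImage R P = convexHull ℝ (⋃ f, ρ f '' (P ∩ relDom R)) := by
  have _ := Fintype.ofFinite F
  apply Set.Subset.antisymm
  · -- `R(P) = ⋃_{x ∈ P ∩ dom} conv ⋃_f ϱ^f(x) ⊆ conv ⋃_f ϱ^f(P ∩ dom R)`
    rintro y ⟨x, hx, hxy⟩
    have hxd : x ∈ P ∩ relDom R := ⟨hx, y, hxy⟩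
    have hyx : y ∈ relImage R {x} := ⟨x, rfl, hxy⟩
    rw [hgen x hxd.2] at hyx
    refine convexHull_mono ?_ hyx
    rintro _ ⟨f, rfl⟩
    exact Set.mem_iUnion.2 ⟨f, x, hxd, rfl⟩
  · -- `conv ⋃_f ϱ^f(conv V) = conv ⋃_{v ∈ V} ⋃_f ϱ^f(v) ⊆ conv ⋃_{v ∈ V} R(v) ⊆ R(conv V) ⊆ R(P)`
    rw [hPV]
    have hsub : (⋃ f, ρ f '' convexHull ℝ V) ⊆ convexHull ℝ (⋃ v ∈ V, relImage R {v}) := by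
      rintro y hy
      obtain ⟨f, hyf⟩ := Set.mem_iUnion.1 hy
      rw [(ρ f).image_convexHull] at hyf
      refine convexHull_mono ?_ hyf
      rintro _ ⟨v, hv, rfl⟩
      have hvd : v ∈ relDom R := by
        have : v ∈ P ∩ relDom R := by rw [hPV]; exact subset_convexHull ℝ V hv
        exact this.2
      refine Set.mem_iUnion.2 ⟨v, Set.mem_iUnion.2 ⟨hv, ?_⟩⟩
      rw [hgen v hvd]
      exact subset_convexHull ℝ _ ⟨f, rfl⟩
    calc convexHull ℝ (⋃ f, ρ f '' convexHull ℝ V)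
        ⊆ convexHull ℝ (⋃ v ∈ V, relImage R {v}) := convexHull_min hsub (convex_convexHull ℝ _)
      _ ⊆ relImage R (convexHull ℝ V) := convexHull_biUnion_relImage_subset hR V
      _ = relImage R (P ∩ relDom R) := by rw [hPV]
      _ ⊆ relImage R P := relImage_mono R Set.inter_subset_left

/-- The reflection relation `R_{a,β}` (`a ≠ 0`) is affinely generated by the identity and the reflection
`ϱ_H` — Proposition 2 of `ReflectionRelations.lean` in the language of §2.
[cite: KaibelPashkovich2011, Prop. 2 (arXiv p. 7)] -/
theorem affinelyGenerated_reflRel {a : ι → ℝ} (ha : a ≠ 0) (β : ℝ) :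
    AffinelyGenerated (reflRel a β)
      (fun b : Bool => if b then (reflectLin a).toAffineMap + AffineMap.const ℝ (ι → ℝ) (((2 * β) / (a ⬝ᵥ a)) • a)
        else AffineMap.id ℝ (ι → ℝ)) := by
  intro x hx
  obtain ⟨y, hxy⟩ := hx
  have hxβ : a ⬝ᵥ x ≤ β := dotProduct_le_of_mem_reflRel hxy
  have hrefl : ((reflectLin a).toAffineMap + AffineMap.const ℝ (ι → ℝ) (((2 * β) / (a ⬝ᵥ a)) • a)) x =
      reflectAt a β x := by
    simp only [AffineMap.coe_add, AffineMap.coe_const, Pi.add_apply, LinearMap.coe_toAffineMap,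
      reflectLin_apply, Function.const_apply, reflectAt]
    rw [add_assoc, ← add_smul]
    congr 2
    ring
  rw [← reflImage_eq_relImage, show reflImage a β {x} = segment ℝ x (reflectAt a β x) from ?_]
  · rw [← convexHull_pair]
    congr 1
    ext z
    simp only [Set.mem_range, Bool.exists_bool, Set.mem_insert_iff, Set.mem_singleton_iff,
      Bool.false_eq_true, ↓reduceIte, AffineMap.id_apply, hrefl]
    constructor
    · rintro (rfl | rfl)
      · exact Or.inl rfl
      · exact Or.inr rfl
    · rintro (h | h)
      · exact Or.inl h.symm
      · exact Or.inr h.symm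
  · rw [← KaibelPashkovich2011_prop2 ha hxβ]
    ext z
    simp [reflImage]

omit [Fintype ι] [Fintype κ] [Fintype μ] in
/-- **KP11 Lemma 1** (for a sequence of length two): if `R₁`, `R₂` are affinely generated by the finite
families `(ϱ₁^{(f₁)})`, `(ϱ₂^{(f₂)})`, then `𝓡(P) ⊆ conv ⋃_{(f₁,f₂)} ϱ₂^{(f₂)} ∘ ϱ₁^{(f₁)} (P ∩ dom 𝓡)`
for the induced relation `𝓡` of `(R₁, R₂)` ("We omit the straight-forward proof"; here it is: affine
maps send convex combinations of generators to convex combinations of composed generators).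
[cite: KaibelPashkovich2011, Lemma 1 (arXiv p. 6)] -/
theorem KaibelPashkovich2011_lemma1_comp {R₁ : Set ((ι → ℝ) × (κ → ℝ))} {R₂ : Set ((κ → ℝ) × (μ → ℝ))}
    {F₁ F₂ : Type} {ρ₁ : F₁ → (ι → ℝ) →ᵃ[ℝ] (κ → ℝ)} {ρ₂ : F₂ → (κ → ℝ) →ᵃ[ℝ] (μ → ℝ)}
    (h₁ : AffinelyGenerated R₁ ρ₁) (h₂ : AffinelyGenerated R₂ ρ₂) (P : Set (ι → ℝ)) :
    relImage (relComp R₁ R₂) P ⊆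
      convexHull ℝ (⋃ f : F₁ × F₂, ((ρ₂ f.2).comp (ρ₁ f.1)) '' (P ∩ relDom (relComp R₁ R₂))) := by
  rintro y ⟨x, hx, z, hxz, hzy⟩
  set T := ⋃ f : F₁ × F₂, ((ρ₂ f.2).comp (ρ₁ f.1)) '' (P ∩ relDom (relComp R₁ R₂)) with hT
  have hxd : x ∈ P ∩ relDom (relComp R₁ R₂) := ⟨hx, y, z, hxz, hzy⟩
  have hz : z ∈ convexHull ℝ (Set.range fun f₁ => ρ₁ f₁ x) := by
    rw [← h₁ x ⟨z, hxz⟩]; exact ⟨x, rfl, hxz⟩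
  have hy : y ∈ convexHull ℝ (Set.range fun f₂ => ρ₂ f₂ z) := by
    rw [← h₂ z ⟨y, hzy⟩]; exact ⟨z, rfl, hzy⟩
  -- every generator image `ϱ₂^{(f₂)}(z)` is a convex combination of composed generators at `x`
  have hgen : (Set.range fun f₂ => ρ₂ f₂ z) ⊆ convexHull ℝ T := by
    rintro _ ⟨f₂, rfl⟩
    have : ρ₂ f₂ z ∈ (ρ₂ f₂) '' convexHull ℝ (Set.range fun f₁ => ρ₁ f₁ x) := ⟨z, hz, rfl⟩
    rw [(ρ₂ f₂).image_convexHull] at this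
    refine convexHull_mono ?_ this
    rintro _ ⟨_, ⟨f₁, rfl⟩, rfl⟩
    exact Set.mem_iUnion.2 ⟨(f₁, f₂), x, hxd, rfl⟩
  exact convexHull_min hgen (convex_convexHull ℝ T) hy

end Literature.Combinatorics.Optimization

end
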